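import Mathlib.Analysis.Complex.Polynomial.Basic
import Literature.Computability.AlgebraicComplexity.KempfNessClosedOrbit
import HarnessLib

/-!
# An `SL`-orbit of tensors is closed if no point of its closure is fixed by a real torus

Support file for the Mumford route to Bürgisser–Ikenmeyer 2017, Prop. 2.10 ("almost all forms of
degree `D ≥ 3` are polystable", `BI17FundamentalInvariantForms.lean`, row BI2017-A of the
val-lit cell): the COMPACTNESS HALF of the argument, for the tensor power action `tensorAct` of
`Matrix σ σ ℂ` on `n`-tensors `(Fin n → σ) → ℂ` (`TensorPowerAction.lean`).

`isClosed_tensorOrbit_of_closure_noFixedTorus`: if NO point `T'` of the classical closure of the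
orbit `{g • T₀ | det g = 1}` is fixed by a non-trivial real diagonal one-parameter subgroup
`s ↦ diag(exp(s e))` (`e : σ → ℝ`, `∑ e = 0`, `e ≠ 0`), then the orbit is closed.

This is the elementary shadow of the Hilbert–Mumford–Birkes–Richardson theorem ("if `G·v` is not
closed, a one-parameter subgroup drives `v` into the boundary", Mumford–Fogarty–Kirwan, GIT,
Ch. 2 §1; Kempf–Ness 1979 §1) that suffices when every closure point is known to have a FINITE
stabiliser (Mumford's stability of smooth hypersurfaces, GIT Prop. 4.2): we do not produce a
destabilising subgroup of `T₀` itself, only a closure point with a positive-dimensional stabiliser.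

## Proof (the `KAK` compactness argument of the tree's `KempfNessClosedOrbit.lean`, Case B replaced)

Let `g_m • T₀ → y` with `det g_m = 1`, and write `g_m = V_m diag(e^{θ^m}) W_m` with `V_m, W_m`
unitary and `∑ θ^m = 0` (`exists_kak_of_det_eq_one`); `‖g_m • T₀‖² = ∑_j e^{2⟨θ^m, ct j⟩}
‖(W_m • T₀)_j‖²` is bounded. If the `θ^m` are frequently bounded, compactness of `U(σ)`
(`Matrix.isCompact_unitaryGroup`) gives a limit `g ∈ SL` with `g • T₀ = y` (Case A, verbatim from
the Kempf–Ness file). Otherwise `‖θ^m‖ → ∞`; along a subsequence `θ^m/‖θ^m‖ → e` (`‖e‖ = 1`,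
`∑ e = 0`) and `W_m → W`. For a word `j` of positive limit weight `⟨e, ct j⟩ > 0` the factor
`e^{2⟨θ^m, ct j⟩}` tends to `+∞`, so boundedness forces `(W • T₀)_j = 0`: the support of `W • T₀`
lies in the half-space `⟨e, ct j⟩ ≤ 0`. Rescaling `W` by an `N`-th root of `det W` puts it in
`SL` without changing the support, and then `diag(exp(s e)) W • T₀` converges, as `s → +∞`, to the
truncation `T'` of `W • T₀` to the words of weight `0` — a point of the orbit closure fixed by every
`diag(exp(s e))`. The hypothesis gives `e = 0`, a contradiction.

Theorem-only file (no definitions, no named facts). Honest framing: an elementary compactness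
lemma of classical invariant theory; nothing here bears on VP versus VNP.

## References

* D. Mumford, J. Fogarty, F. Kirwan, *Geometric Invariant Theory*, 3rd ed., Springer (1994),
  Ch. 2 §1 (the numerical criterion) and Ch. 4 §2, Prop. 4.2 (smooth hypersurfaces are stable).
  [MumfordFogartyKirwan1994]
* G. Kempf, L. Ness, *The length of vectors in representation spaces*, LNM 732 (1979), §1.
* P. Bürgisser, C. Ikenmeyer, *Fundamental invariants of orbit closures*, J. Algebra 477 (2017),
  §2.2 (polystability), Prop. 2.10. [BurgisserIkenmeyer2017]
-/

noncomputable section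

open Finset Filter
open scoped Matrix ComplexOrder Topology

namespace Literature.Computability.AlgebraicComplexity

section NoFixedTorus

variable {σ : Type*} [Fintype σ] [DecidableEq σ] {n : ℕ}

/-- The diagonal scaling `diag(exp(s e))` acts on the `j`-th coordinate of a tensor by the factor
`exp(s ⟨e, ct j⟩)`, `⟨e, ct j⟩ = ∑ k, e (j k)` (the torus weights of Kempf–Ness 1979 §1 /
Bürgisser–Ikenmeyer 2017 §2.2, proof of Prop. 2.8). [cite: BurgisserIkenmeyer2017, §2.2 (proof of Prop. 2.8: torus weights)] -/
theorem tensorAct_diagonal_exp_apply (e : σ → ℝ) (s : ℝ) (T : (Fin n → σ) → ℂ) (j : Fin n → σ) :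
    tensorAct (Matrix.diagonal fun c => (Real.exp (s * e c) : ℂ)) T j =
      (Real.exp (s * ∑ k, e (j k)) : ℂ) * T j := by
  rw [tensorAct_diagonal]
  simp only
  rw [← Complex.ofReal_prod, ← Real.exp_sum, Finset.mul_sum]

/-- **An `SL`-orbit of tensors is closed as soon as no point of its closure is fixed by a
non-trivial real one-parameter torus.** If every `T'` in the classical closure of
`{g • T₀ | det g = 1}` that is fixed by all `diag(exp(s e))`, `s ∈ ℝ`, for some real `e` with
`∑ e = 0`, has `e = 0`, then `{g • T₀ | det g = 1}` is closed (the compactness half of Mumford's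
stability argument for smooth hypersurfaces, GIT Prop. 4.2, in Kempf–Ness `KAK` form). A weak form
of the Hilbert–Mumford–Birkes–Richardson theorem of GIT Ch. 2 §1 (a non-closed orbit degenerates
along a one-parameter subgroup): here only a CLOSURE POINT with a non-trivial torus in its
stabiliser is produced, which is all Mumford's Prop. 4.2 consumes; OUR elementary proof, not the
printed one. [cite: MumfordFogartyKirwan1994, Ch. 2 §1 Thm. 2.1 (weak form) and Ch. 4 §2 Prop. 4.2 (use)] -/
theorem isClosed_tensorOrbit_of_closure_noFixedTorus (T₀ : (Fin n → σ) → ℂ)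
    (H : ∀ T' ∈ closure {S : (Fin n → σ) → ℂ | ∃ g : Matrix σ σ ℂ, g.det = 1 ∧ tensorAct g T₀ = S},
      ∀ e : σ → ℝ, ∑ a, e a = 0 →
        (∀ s : ℝ, tensorAct (Matrix.diagonal fun c => (Real.exp (s * e c) : ℂ)) T' = T') → e = 0) :
    IsClosed {S : (Fin n → σ) → ℂ | ∃ g : Matrix σ σ ℂ, g.det = 1 ∧ tensorAct g T₀ = S} := by
  haveI : FirstCountableTopology (Matrix σ σ ℂ) :=
    inferInstanceAs (FirstCountableTopology (σ → σ → ℂ))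
  rw [← closure_subset_iff_isClosed]
  intro y hy
  obtain ⟨S, hS, hlim⟩ := mem_closure_iff_seq_limit.mp hy
  choose g hgdet hgS using hS
  -- `KAK` decompositions
  choose V W θ hV hW hθ hkak using fun m => exists_kak_of_det_eq_one (g m) (hgdet m)
  have hVV : ∀ m, (V m)ᴴ * V m = 1 := fun m => by
    have := Matrix.mem_unitaryGroup_iff'.mp (hV m); rwa [Matrix.star_eq_conjTranspose] at this
  -- the norms `‖S m‖²` are bounded ...
  obtain ⟨C, hC⟩ : ∃ C, ∀ m, tnormSq (S m) ≤ C := by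
    have h := (continuous_tnormSq.tendsto y).comp hlim
    obtain ⟨C, hC⟩ := h.bddAbove_range
    exact ⟨C, fun m => hC ⟨m, rfl⟩⟩
  -- ... and given by the torus weights in the frame `W m`
  have hnormS : ∀ m, tnormSq (S m) =
      ∑ j : Fin n → σ, Real.exp (2 * ∑ k, θ m (j k)) * ‖tensorAct (W m) T₀ j‖ ^ 2 := by
    intro m
    rw [← hgS m, hkak m, tnormSq_tensorAct_kak (hVV m)]
  -- Case distinction: are the `θ m` frequently bounded?
  by_cases hfreq : ∃ R : ℝ, ∃ᶠ m in atTop, ‖θ m‖ ≤ R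
  · /- Case A: a bounded subsequence; compactness gives a limit `g∞ ∈ SL` with `g∞ • T₀ = y`. -/
    obtain ⟨R, hR⟩ := hfreq
    obtain ⟨φ₁, hφ₁, hφ₁R⟩ := Filter.extraction_of_frequently_atTop hR
    set K : Set (Matrix σ σ ℂ × ((σ → ℝ) × Matrix σ σ ℂ)) :=
      (Matrix.unitaryGroup σ ℂ : Set (Matrix σ σ ℂ)) ×ˢ
        (Metric.closedBall (0 : σ → ℝ) R ×ˢ (Matrix.unitaryGroup σ ℂ : Set (Matrix σ σ ℂ))) with hK
    have hKc : IsCompact K :=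
      Literature.NumberTheory.Automorphic.Matrix.isCompact_unitaryGroup.prod
        ((isCompact_closedBall _ _).prod
          Literature.NumberTheory.Automorphic.Matrix.isCompact_unitaryGroup)
    set x : ℕ → Matrix σ σ ℂ × ((σ → ℝ) × Matrix σ σ ℂ) :=
      fun m => (V (φ₁ m), (θ (φ₁ m), W (φ₁ m))) with hx
    have hxK : ∀ m, x m ∈ K := fun m =>
      ⟨hV _, ⟨by simpa using hφ₁R m, hW _⟩⟩
    obtain ⟨pt, -, φ₂, hφ₂, hxlim⟩ := hKc.tendsto_subseq hxK
    -- the limit matrix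
    set F : Matrix σ σ ℂ × ((σ → ℝ) × Matrix σ σ ℂ) → Matrix σ σ ℂ :=
      fun z => z.1 * Matrix.diagonal (fun c => (Real.exp (z.2.1 c) : ℂ)) * z.2.2 with hF
    have hFcont : Continuous F := continuous_kakMap
    have hFx : ∀ m, F (x (φ₂ m)) = g (φ₁ (φ₂ m)) := fun m => by
      rw [hF, hx]; exact (hkak _).symm
    have hglim : Tendsto (fun m => g (φ₁ (φ₂ m))) atTop (𝓝 (F pt)) := by
      have := (hFcont.tendsto pt).comp hxlim
      refine this.congr fun m => ?_
      exact hFx m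
    refine ⟨F pt, ?_, ?_⟩
    · -- `det (F pt) = 1`
      have h1 : Tendsto (fun m => (g (φ₁ (φ₂ m))).det) atTop (𝓝 (F pt).det) :=
        ((continuous_id.matrix_det).tendsto _).comp hglim
      have h2 : Tendsto (fun m => (g (φ₁ (φ₂ m))).det) atTop (𝓝 1) := by
        simp_rw [hgdet]; exact tendsto_const_nhds
      exact tendsto_nhds_unique h1 h2
    · -- `F pt • T₀ = y`
      have h1 : Tendsto (fun m => tensorAct (g (φ₁ (φ₂ m))) T₀) atTop (𝓝 (tensorAct (F pt) T₀)) :=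
        ((continuous_tensorAct_left T₀).tendsto _).comp hglim
      have h2 : Tendsto (fun m => tensorAct (g (φ₁ (φ₂ m))) T₀) atTop (𝓝 y) := by
        simp_rw [hgS]
        exact hlim.comp (hφ₁.comp hφ₂).tendsto_atTop
      exact tendsto_nhds_unique h1 h2
  · /- Case B: `‖θ m‖ → ∞`; a closure point fixed by a non-trivial real torus appears. -/
    exfalso
    have hdiv : Tendsto (fun m => ‖θ m‖) atTop atTop := by
      rw [Filter.tendsto_atTop]
      intro R
      have : ∀ᶠ m in atTop, ¬ (‖θ m‖ ≤ R) := Filter.not_frequently.mp (fun h => hfreq ⟨R, h⟩)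
      filter_upwards [this] with m hm
      exact (not_le.mp hm).le
    -- normalised weights
    set rr : ℕ → ℝ := fun m => ‖θ m‖ with hrr
    set ε : ℕ → σ → ℝ := fun m => (rr m)⁻¹ • θ m with hε
    have hpos_ev : ∀ᶠ m in atTop, 0 < rr m := hdiv.eventually_gt_atTop 0
    obtain ⟨φ₁, hφ₁, hφ₁pos⟩ := Filter.extraction_of_frequently_atTop hpos_ev.frequently
    have hεnorm : ∀ m, ‖ε (φ₁ m)‖ = 1 := fun m => by
      rw [hε]
      simp only
      rw [norm_smul, norm_inv, norm_norm, inv_mul_cancel₀ (hφ₁pos m).ne']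
    have hεsum : ∀ m, ∑ a, ε (φ₁ m) a = 0 := fun m => by
      rw [hε]
      simp only [Pi.smul_apply, smul_eq_mul, ← Finset.mul_sum, hθ, mul_zero]
    have hθε : ∀ m a, θ (φ₁ m) a = rr (φ₁ m) * ε (φ₁ m) a := fun m a => by
      rw [hε]
      simp only [Pi.smul_apply, smul_eq_mul]
      rw [← mul_assoc, mul_inv_cancel₀ (hφ₁pos m).ne', one_mul]
    -- compactness: `ε → e`, `W → Winf` along a further subsequence
    set K : Set ((σ → ℝ) × Matrix σ σ ℂ) :=
      Metric.sphere (0 : σ → ℝ) 1 ×ˢ (Matrix.unitaryGroup σ ℂ : Set (Matrix σ σ ℂ)) with hK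
    have hKc : IsCompact K :=
      (isCompact_sphere _ _).prod Literature.NumberTheory.Automorphic.Matrix.isCompact_unitaryGroup
    set x : ℕ → (σ → ℝ) × Matrix σ σ ℂ := fun m => (ε (φ₁ m), W (φ₁ m)) with hx
    have hxK : ∀ m, x m ∈ K := fun m =>
      ⟨mem_sphere_zero_iff_norm.mpr (hεnorm m), hW _⟩
    obtain ⟨⟨e, Winf⟩, ⟨he1, hWinf⟩, φ₂, hφ₂, hxlim⟩ := hKc.tendsto_subseq hxK
    set ψ : ℕ → ℕ := fun m => φ₁ (φ₂ m) with hψ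
    have hεlim : Tendsto (fun m => ε (ψ m)) atTop (𝓝 e) := (continuous_fst.tendsto _).comp hxlim
    have hWlim : Tendsto (fun m => W (ψ m)) atTop (𝓝 Winf) := (continuous_snd.tendsto _).comp hxlim
    have hεlim' : ∀ c, Tendsto (fun m => ε (ψ m) c) atTop (𝓝 (e c)) := fun c =>
      ((continuous_apply c).tendsto _).comp hεlim
    have hrlim : Tendsto (fun m => rr (ψ m)) atTop atTop := hdiv.comp (hφ₁.comp hφ₂).tendsto_atTop
    have hWinf'' : Winf * star Winf = 1 := Matrix.mem_unitaryGroup_iff.mp hWinf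
    -- properties of the limit weight `e`
    have hesum : ∑ a, e a = 0 := by
      have h1 : Tendsto (fun m => ∑ a, ε (ψ m) a) atTop (𝓝 (∑ a, e a)) :=
        tendsto_finsetSum _ fun a _ => hεlim' a
      have h2 : Tendsto (fun m => ∑ a, ε (ψ m) a) atTop (𝓝 0) := by
        simp_rw [hψ, hεsum]; exact tendsto_const_nhds
      exact tendsto_nhds_unique h1 h2
    have he_ne : e ≠ 0 := by
      intro h0
      rw [mem_sphere_zero_iff_norm, h0, norm_zero] at he1
      exact zero_ne_one he1
    -- (1) the coordinates of positive limit weight vanish in the limit frame `Winf`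
    have hvanish : ∀ j : Fin n → σ, 0 < ∑ k, e (j k) → tensorAct Winf T₀ j = 0 := by
      intro j hj
      -- the `j`-th term of `‖S m‖²` is bounded by `C`
      have hterm : ∀ m, Real.exp (2 * ∑ k, θ m (j k)) * ‖tensorAct (W m) T₀ j‖ ^ 2 ≤ C := by
        intro m
        refine le_trans ?_ (hC m)
        rw [hnormS m]
        exact Finset.single_le_sum (f := fun i => Real.exp (2 * ∑ k, θ m (i k)) *
          ‖tensorAct (W m) T₀ i‖ ^ 2) (fun i _ => by positivity) (Finset.mem_univ j)
      -- along `ψ` the weight `2 ⟨θ, ct j⟩ = 2 rr ⟨ε, ct j⟩` tends to `+∞`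
      have hw : Tendsto (fun m => ∑ k, ε (ψ m) (j k)) atTop (𝓝 (∑ k, e (j k))) :=
        tendsto_finsetSum _ fun k _ => hεlim' (j k)
      have hwpos : ∀ᶠ m in atTop, (∑ k, e (j k)) / 2 ≤ ∑ k, ε (ψ m) (j k) :=
        (hw.eventually (eventually_ge_nhds (by linarith))).mono fun m hm => hm
      have hrpos : ∀ᶠ m in atTop, 0 ≤ rr (ψ m) := (hrlim.eventually_ge_atTop 0)
      have hlin : Tendsto (fun m => rr (ψ m) * ((∑ k, e (j k)) / 2)) atTop atTop :=
        hrlim.atTop_mul_const (by linarith)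
      have hwt : Tendsto (fun m => 2 * ∑ k, θ (ψ m) (j k)) atTop atTop := by
        refine tendsto_atTop_mono' atTop ?_ (Tendsto.const_mul_atTop (by norm_num : (0 : ℝ) < 2) hlin)
        filter_upwards [hwpos, hrpos] with m hm hr
        have hθm : ∑ k, θ (ψ m) (j k) = rr (ψ m) * ∑ k, ε (ψ m) (j k) := by
          rw [Finset.mul_sum]
          exact Finset.sum_congr rfl fun k _ => hθε (φ₂ m) (j k)
        rw [hθm]
        have := mul_le_mul_of_nonneg_left hm hr
        linarith
      have hexp : Tendsto (fun m => Real.exp (2 * ∑ k, θ (ψ m) (j k))) atTop atTop :=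
        Real.tendsto_exp_atTop.comp hwt
      -- hence `‖(W (ψ m) • T₀) j‖² ≤ C · exp(−2⟨θ, ct j⟩) → 0`
      have hup : Tendsto (fun m => C * (Real.exp (2 * ∑ k, θ (ψ m) (j k)))⁻¹) atTop (𝓝 0) := by
        have := hexp.inv_tendsto_atTop.const_mul C
        rwa [mul_zero] at this
      have hsq0 : Tendsto (fun m => ‖tensorAct (W (ψ m)) T₀ j‖ ^ 2) atTop (𝓝 0) := by
        refine squeeze_zero (fun m => by positivity) (fun m => ?_) hup
        rw [← div_eq_mul_inv, le_div_iff₀ (Real.exp_pos _), mul_comm]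
        exact hterm (ψ m)
      have hsq : Tendsto (fun m => ‖tensorAct (W (ψ m)) T₀ j‖ ^ 2) atTop
          (𝓝 (‖tensorAct Winf T₀ j‖ ^ 2)) := by
        have : Tendsto (fun m => tensorAct (W (ψ m)) T₀ j) atTop (𝓝 (tensorAct Winf T₀ j)) :=
          ((continuous_apply j).tendsto _).comp
            (((continuous_tensorAct_left T₀).tendsto _).comp hWlim)
        exact (this.norm).pow 2
      have h0 : ‖tensorAct Winf T₀ j‖ ^ 2 = 0 := tendsto_nhds_unique hsq hsq0
      exact norm_eq_zero.mp (pow_eq_zero_iff two_ne_zero |>.mp h0)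
    -- (2) rescale `Winf` into `SL`
    haveI : Nonempty σ := by
      by_contra hne
      rw [not_nonempty_iff] at hne
      exact he_ne (funext fun c => (IsEmpty.false c).elim)
    have hdetW : Winf.det ≠ 0 := by
      intro h0
      have := congrArg Matrix.det hWinf''
      rw [Matrix.det_mul, h0, zero_mul, Matrix.det_one] at this
      exact zero_ne_one this
    obtain ⟨c, hc⟩ := IsAlgClosed.exists_pow_nat_eq Winf.det (Fintype.card_pos (α := σ))
    have hc0 : c ≠ 0 := by
      rintro rfl
      rw [zero_pow (Fintype.card_pos (α := σ)).ne'] at hc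
      exact hdetW hc.symm
    set W₁ : Matrix σ σ ℂ := c⁻¹ • Winf with hW₁
    have hW₁det : W₁.det = 1 := by
      rw [hW₁, Matrix.det_smul, ← hc, inv_pow, inv_mul_cancel₀ (pow_ne_zero _ hc0)]
    set T : (Fin n → σ) → ℂ := tensorAct W₁ T₀ with hT
    have hTvanish : ∀ j : Fin n → σ, 0 < ∑ k, e (j k) → T j = 0 := by
      intro j hj
      rw [hT, hW₁, tensorAct_smul_left, Pi.smul_apply, hvanish j hj, smul_zero]
    -- (3) the one-parameter limit `diag(exp(s e)) • T → T'`, the truncation to weight `0`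
    set T' : (Fin n → σ) → ℂ := fun j => if ∑ k, e (j k) = 0 then T j else 0 with hT'
    have hconv : Tendsto (fun s : ℝ => tensorAct (Matrix.diagonal fun c => (Real.exp (s * e c) : ℂ)) T)
        atTop (𝓝 T') := by
      rw [tendsto_pi_nhds]
      intro j
      simp_rw [tensorAct_diagonal_exp_apply]
      rcases lt_trichotomy (∑ k, e (j k)) 0 with hneg | hzero | hpos
      · -- negative weight: the factor tends to `0`
        have hT'j : T' j = 0 := by rw [hT']; exact if_neg hneg.ne
        rw [hT'j]
        have h1 : Tendsto (fun s : ℝ => s * ∑ k, e (j k)) atTop atBot :=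
          tendsto_id.atTop_mul_const_of_neg hneg
        have h2 : Tendsto (fun s : ℝ => Real.exp (s * ∑ k, e (j k))) atTop (𝓝 0) :=
          Real.tendsto_exp_atBot.comp h1
        have h3 : Tendsto (fun s : ℝ => (Real.exp (s * ∑ k, e (j k)) : ℂ)) atTop (𝓝 0) := by
          have := (Complex.continuous_ofReal.tendsto 0).comp h2
          rwa [Complex.ofReal_zero] at this
        have := h3.mul_const (T j)
        rwa [zero_mul] at this
      · -- weight zero: constant
        have hT'j : T' j = T j := by rw [hT']; exact if_pos hzero
        rw [hT'j]
        simp_rw [hzero, mul_zero, Real.exp_zero, Complex.ofReal_one, one_mul]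
        exact tendsto_const_nhds
      · -- positive weight: `T j = 0`
        have hT'j : T' j = 0 := by rw [hT']; exact if_neg hpos.ne'
        rw [hT'j, hTvanish j hpos]
        simp_rw [mul_zero]
        exact tendsto_const_nhds
    have hT'mem : T' ∈ closure {S : (Fin n → σ) → ℂ | ∃ g : Matrix σ σ ℂ, g.det = 1 ∧ tensorAct g T₀ = S} := by
      refine mem_closure_of_tendsto hconv (Filter.Eventually.of_forall fun s => ?_)
      refine ⟨(Matrix.diagonal fun c => (Real.exp (s * e c) : ℂ)) * W₁, ?_, ?_⟩
      · rw [Matrix.det_mul, det_diagonal_exp_eq_one hesum, one_mul, hW₁det]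
      · rw [tensorAct_mul]
    have hT'fix : ∀ s : ℝ, tensorAct (Matrix.diagonal fun c => (Real.exp (s * e c) : ℂ)) T' = T' :=
      fun s => tensorAct_diagonal_exp_eq_self (fun j hj => by
        by_contra h
        apply hj
        rw [hT']
        exact if_neg h) s
    exact he_ne (H T' hT'mem e hesum hT'fix)

end NoFixedTorus

end Literature.Computability.AlgebraicComplexity

end
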